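import Summits.Ventures.CertifiedManyBodySolver.Observables.PairLROTorusDictionary
import Summits.Ventures.CertifiedManyBodySolver.Rows.DopedTLCorr
import HarnessLib

/-!
# The d50 sibling: a thermodynamic-limit ORBIT ROW on the box pair word (any certified source — window
# certificate, λ-form leg-J certificate, claim node) bounds the `liminf` of `HubbardSuperconductivity`'s
# pair-field LRO sequence — no certificate identity enters, only the row predicate

HONEST FRAMING: first certified bounds on pairing observables; not a superconductivity verdict; every
number certified (two lineages + referee) or labelled float. Crew hubbard-obs (D-0042), seat hubbard-obs-p1
(`prover-hubbard-obs-p1-g0-0`), lead ruling (uu2)/(uu3)(a). Theorem-only; zero compute; no named fact; no `sorry`.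

`Observables/PairLROTorusCeiling.lean` read a λ-form CERTIFICATE on the finite tori. The registry's cells
are ROW PREDICATES (`Rows/DopedTLCorr.lean`: statements about the torus-LIMIT states), certified outside
Lean and carried as hypotheses (claim nodes). This file closes the gap between the two: from

* an ORBIT LOWER row on the NEGATED box pair word,
  `SquareTTPrimeCorrOrbitLowerRow tp U n u r S Λ_B (−pairBoxWord S_d g_d B)` (`S ∋ 1`; i.e. for every torus
  limit `ω` of the sector ground states with `e₀ ≤ u`, `|S|⁻¹ Σ_{γ∈S} Re ω_{γΛ_B}(Γ(d4Emb γ 0) pairBoxWord B) ≤ −r`),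
* the certified cap `energyDensityTT' 1 tp U n ≤ u`,

and ANY family `ψ_L` of unit ground states of the sectors `(rectN n L, S^z = 0)` of `hubbardTorusTT' L 1 tp U`,
the summit's sequence `u_k = |Λ_{2k}|⁻² Σ_{x,y∈Λ_{2k}} P_d(2k; x, y) = (2k)⁻⁴ Re⟨ψ_{2k}, Δ_d†Δ_d ψ_{2k}⟩` obeys
**`liminf_k u_k ≤ −r/|B|²`** (`liminf_dWavePairFieldLRO_le_of_orbitLowerRow_neg`). Proof: compactness
(`InfVolFermionState.exists_isTorusLimitOf_subseq`: a subsequence `2φ(j)` has a torus limit `ω`), the row at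
`ω`, the convergence of the finitely many rotated box words' translation averages to their values in `ω`
(definition of `IsTorusLimitOf`), the dictionary `re_orbitState_spaceGroupUnitary_fermionEmbed_toTorusEmb`
(orbit state = mean of those averages) and the KINEMATIC domination of part 1
(`sq_card_mul_pairFieldDensity_le_re_orbitState_pairBoxWord`: `|B|² u_k ≤ Re ω̄_{ψ_{2k}}(Γ(ι) pairBoxWord B)`);
so `u_{φ(j)}` is eventually `≤ −r/|B|² + ε`, i.e. frequently in `k`, for every `ε > 0`. Corollaries: the
plain UPPER row (`S = {1}`, `SquareTTPrimeCorrUpperRow … fu Λ_B (pairBoxWord B)` ⇒ `liminf ≤ fu/|B|²`,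
`liminf_dWavePairFieldLRO_le_of_upperRow`) and the M3′ forms with the cap discharged by `M3EnergyUpperRow tp hi`.
HONEST: a certified CEILING on the summit's LRO sequence at one `(U, n, t′)`; neither proves nor refutes the
summit; no number lives in this file.
-/

noncomputable section

namespace Summit.Ventures.CertifiedManyBodySolver.Observables

open Matrix Finset Literature.MathematicalPhysics.QuantumLattice Literature.Probability.LatticeModels
open Literature.MathematicalPhysics.QuantumLattice.HubbardWave0 ThermodynamicLimit Filter Topology
open Literature.MathematicalPhysics.QuantumManyBody.StateRelaxation
open scoped ComplexOrder BigOperators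

section Row

/-- **ORBIT row on `−pairBoxWord B` ⇒ ceiling on the `liminf` of the summit's pair-field LRO sequence.**
See the module docstring. [cite: Scalapino1995, §2 eq. (2.4)] -/
theorem liminf_dWavePairFieldLRO_le_of_orbitLowerRow_neg {tp U n : ℝ} {u r : ℚ}
    {S : Finset (DihedralGroup 4)} (h1 : (1 : DihedralGroup 4) ∈ S) {B : Finset (Site 2)} (hBne : B.Nonempty)
    (hrow : SquareTTPrimeCorrOrbitLowerRow tp U n u r S (B.biUnion (pairRegion (insert (0 : Site 2) unitSteps)))
      (-pairBoxWord (insert (0 : Site 2) unitSteps) dWaveFormFactor B))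
    (hu : energyDensityTT' 1 tp U n ≤ ((u : ℚ) : ℝ))
    (ψ : ∀ L, Fock (Orb (FermionTorus 2 L)))
    (hψ : ∀ L, IsGroundStateInSector (hubbardTorusTT' L 1 tp U) (rectN n L) 0 (ψ L))
    (hψ1 : ∀ L, star (ψ L) ⬝ᵥ ψ L = 1) :
    liminf (fun k : ℕ => (∑ x ∈ halfOpenBox 2 (2 * k), ∑ y ∈ halfOpenBox 2 (2 * k),
        torusPullback (pairFieldCorr dWaveFormFactor ψ) (2 * k) x y) /
          ((#(halfOpenBox 2 (2 * k)) : ℝ)) ^ 2) atTop ≤ -((r : ℚ) : ℝ) / ((B.card : ℝ)) ^ 2 := by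
  set Λ' : Finset (Site 2) := B.biUnion (pairRegion (insert (0 : Site 2) unitSteps)) with hΛ'
  set X : FermionOp Λ' := pairBoxWord (insert (0 : Site 2) unitSteps) dWaveFormFactor B with hX
  set C : ℝ := -((r : ℚ) : ℝ) / ((B.card : ℝ)) ^ 2 with hC
  set useq : ℕ → ℝ := fun k => (∑ x ∈ halfOpenBox 2 (2 * k), ∑ y ∈ halfOpenBox 2 (2 * k),
      torusPullback (pairFieldCorr dWaveFormFactor ψ) (2 * k) x y) /
        ((#(halfOpenBox 2 (2 * k)) : ℝ)) ^ 2 with huseq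
  change liminf useq atTop ≤ C
  have hBpos : 0 < ((B.card : ℝ)) ^ 2 := by
    have : 0 < (B.card : ℝ) := by exact_mod_cast hBne.card_pos
    positivity
  have hSpos : 0 < (S.card : ℝ) := by exact_mod_cast Finset.card_pos.2 ⟨1, h1⟩
  -- the `k`-th term (for `k ≥ 1`) is the pair-field density of `ψ_{2k}` (`2k = n + 1`)
  have hterm : ∀ k : ℕ, 1 ≤ k → ∃ m : ℕ, 2 * k = m + 1 ∧
      useq k = (expect ((pairField dWaveFormFactor (m + 1))ᴴ * pairField dWaveFormFactor (m + 1)) (ψ (m + 1))).re /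
        (((m + 1 : ℕ) : ℝ)) ^ 4 := by
    intro k hk
    refine ⟨2 * k - 1, by omega, ?_⟩
    have e : 2 * k = (2 * k - 1) + 1 := by omega
    simp only [huseq]
    rw [e, torusLROSeq_pairFieldCorr_succ]
    rfl
  have hnonneg : ∀ k : ℕ, 1 ≤ k → 0 ≤ useq k := by
    intro k hk
    obtain ⟨m, -, hm⟩ := hterm k hk
    rw [hm]
    refine div_nonneg ?_ (by positivity)
    exact (posSemidef_conjTranspose_mul_self (pairField dWaveFormFactor (m + 1))).re_dotProduct_nonneg (ψ (m + 1))
  have hbdd : IsBoundedUnder (· ≥ ·) atTop useq :=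
    isBoundedUnder_of_eventually_ge (a := 0) (Filter.eventually_atTop.2 ⟨1, fun k hk => hnonneg k hk⟩)
  -- compactness along the even sides: a torus limit `ω` along `2 φ(j)`
  have hL2 : Tendsto (fun k : ℕ => 2 * k) atTop atTop := Filter.tendsto_id.const_mul_atTop' (by norm_num)
  obtain ⟨φ, hφ, ω, hω⟩ := InfVolFermionState.exists_isTorusLimitOf_subseq (d := 2) ψ hL2 fun j => hψ1 (2 * j)
  have hLφ : Tendsto ((fun k : ℕ => 2 * k) ∘ φ) atTop atTop := hL2.comp hφ.tendsto_atTop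
  -- the row at `ω`: the orbit mean of the rotated box words is `≤ −r`
  have hrowω := hrow ω ((fun k : ℕ => 2 * k) ∘ φ) ψ hLφ (fun j => hψ _) (fun j => hψ1 _) hω hu
  have hneg : ∑ g ∈ S, (ω.expect (d4ShiftSet g 0 Λ') (fermionEmbed (PolySite.d4Emb g 0 Λ') (-X))).re =
      -∑ g ∈ S, (ω.expect (d4ShiftSet g 0 Λ') (fermionEmbed (PolySite.d4Emb g 0 Λ') X)).re := by
    rw [← Finset.sum_neg_distrib]
    refine Finset.sum_congr rfl fun g _ => ?_
    rw [map_neg, map_neg, Complex.neg_re]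
  rw [hneg] at hrowω
  -- the orbit means along the subsequence converge to the orbit mean in `ω`
  set M : ℕ → ℝ := fun j => (S.card : ℝ)⁻¹ * ∑ g ∈ S,
      (torusAvgExpect (2 * φ j) (d4ShiftSet g 0 Λ') (fermionEmbed (PolySite.d4Emb g 0 Λ') X) (ψ (2 * φ j))).re
    with hM
  have hMlim : Tendsto M atTop (𝓝 ((S.card : ℝ)⁻¹ * ∑ g ∈ S,
      (ω.expect (d4ShiftSet g 0 Λ') (fermionEmbed (PolySite.d4Emb g 0 Λ') X)).re)) := by
    refine (tendsto_finsetSum S fun g _ => ?_).const_mul _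
    exact (Complex.continuous_re.tendsto _).comp (hω (d4ShiftSet g 0 Λ') _)
  have hMle : (S.card : ℝ)⁻¹ * ∑ g ∈ S,
      (ω.expect (d4ShiftSet g 0 Λ') (fermionEmbed (PolySite.d4Emb g 0 Λ') X)).re ≤ -((r : ℚ) : ℝ) := by
    rw [mul_neg] at hrowω
    linarith
  -- along the subsequence, the summit term is dominated by `M_j / |B|²` (kinematics), eventually
  have hev : ∀ᶠ j : ℕ in atTop, useq (φ j) ≤ M j / ((B.card : ℝ)) ^ 2 := by
    filter_upwards [(eventually_injOn_proj_of_tendsto Λ' hLφ), hLφ.eventually_ge_atTop 3,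
      (hφ.tendsto_atTop).eventually_ge_atTop 1] with j hInj hL3 hj1
    obtain ⟨m, hm2, hterm'⟩ := hterm (φ j) hj1
    have hm2' : 2 * φ j = m + 1 := hm2
    simp only [Function.comp_apply] at hInj hL3
    rw [hterm', hM]
    dsimp only
    rw [hm2'] at hInj ⊢
    have hkin := sq_card_mul_pairFieldDensity_le_re_orbitState_pairBoxWord h1 B hInj (ψ (m + 1))
    rw [re_orbitState_spaceGroupUnitary_fermionEmbed_toTorusEmb S hInj] at hkin
    simp_rw [← torusAvgExpect_eq] at hkin
    rw [le_div_iff₀ hBpos, mul_comm]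
    exact hkin
  -- hence for every `ε > 0`, frequently `useq k ≤ C + ε`
  refine le_of_forall_pos_le_add fun ε hε => ?_
  have hMev : ∀ᶠ j : ℕ in atTop, M j / ((B.card : ℝ)) ^ 2 ≤ C + ε := by
    have hlim2 : Tendsto (fun j => M j / ((B.card : ℝ)) ^ 2) atTop
        (𝓝 (((S.card : ℝ)⁻¹ * ∑ g ∈ S,
          (ω.expect (d4ShiftSet g 0 Λ') (fermionEmbed (PolySite.d4Emb g 0 Λ') X)).re) / ((B.card : ℝ)) ^ 2)) :=
      hMlim.div_const _
    have hlt : ((S.card : ℝ)⁻¹ * ∑ g ∈ S,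
        (ω.expect (d4ShiftSet g 0 Λ') (fermionEmbed (PolySite.d4Emb g 0 Λ') X)).re) / ((B.card : ℝ)) ^ 2 <
        C + ε := by
      have hle : ((S.card : ℝ)⁻¹ * ∑ g ∈ S,
          (ω.expect (d4ShiftSet g 0 Λ') (fermionEmbed (PolySite.d4Emb g 0 Λ') X)).re) / ((B.card : ℝ)) ^ 2 ≤ C := by
        rw [hC]
        exact div_le_div_of_nonneg_right hMle hBpos.le
      linarith
    exact (hlim2.eventually (gt_mem_nhds hlt)).mono fun j hj => hj.le
  have hfreq : ∃ᶠ k : ℕ in atTop, useq k ≤ C + ε := by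
    have hevφ : ∀ᶠ j : ℕ in atTop, useq (φ j) ≤ C + ε := by
      filter_upwards [hev, hMev] with j h1' h2'
      exact h1'.trans h2'
    exact hφ.tendsto_atTop.frequently hevφ.frequently
  exact liminf_le_of_frequently_le hfreq hbdd

/-- **Plain UPPER row (`S = {1}`) ⇒ the same ceiling**: `SquareTTPrimeCorrUpperRow tp U n u fu Λ_B (pairBoxWord B)`
and `energyDensityTT' 1 tp U n ≤ u` give `liminf_k u_k ≤ fu/|B|²` for every family of unit sector ground states.
[cite: Scalapino1995, §2 eq. (2.4)] -/
theorem liminf_dWavePairFieldLRO_le_of_upperRow {tp U n : ℝ} {u fu : ℚ} {B : Finset (Site 2)} (hBne : B.Nonempty)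
    (hrow : SquareTTPrimeCorrUpperRow tp U n u fu (B.biUnion (pairRegion (insert (0 : Site 2) unitSteps)))
      (pairBoxWord (insert (0 : Site 2) unitSteps) dWaveFormFactor B))
    (hu : energyDensityTT' 1 tp U n ≤ ((u : ℚ) : ℝ))
    (ψ : ∀ L, Fock (Orb (FermionTorus 2 L)))
    (hψ : ∀ L, IsGroundStateInSector (hubbardTorusTT' L 1 tp U) (rectN n L) 0 (ψ L))
    (hψ1 : ∀ L, star (ψ L) ⬝ᵥ ψ L = 1) :
    liminf (fun k : ℕ => (∑ x ∈ halfOpenBox 2 (2 * k), ∑ y ∈ halfOpenBox 2 (2 * k),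
        torusPullback (pairFieldCorr dWaveFormFactor ψ) (2 * k) x y) /
          ((#(halfOpenBox 2 (2 * k)) : ℝ)) ^ 2) atTop ≤ ((fu : ℚ) : ℝ) / ((B.card : ℝ)) ^ 2 := by
  have hlow : SquareTTPrimeCorrLowerRow tp U n u (-fu) (B.biUnion (pairRegion (insert (0 : Site 2) unitSteps)))
      (-pairBoxWord (insert (0 : Site 2) unitSteps) dWaveFormFactor B) :=
    SquareTTPrimeCorrLowerRow.of_upper_neg (by rw [neg_neg, neg_neg]; exact hrow)
  have horb := (squareTTPrimeCorrOrbitLowerRow_singleton_one_iff).2 hlow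
  have h := liminf_dWavePairFieldLRO_le_of_orbitLowerRow_neg (Finset.mem_singleton_self _) hBne horb hu ψ hψ hψ1
  push_cast at h
  rw [neg_neg] at h
  exact h

/-- **M3′ form, ORBIT row** (`U = 8`, `n = 7/8`, hopping `tp`; the shape of a leg-J λ-form claim node for `F_B`):
`M3CorrOrbitLowerRow tp u r S Λ_B (−pairBoxWord B)` with the cap discharged by `M3EnergyUpperRow tp hi`, `hi ≤ u`,
gives `liminf_k u_k ≤ −r/|B|²` for EVERY family of unit `(rectN (7/8) L, S^z = 0)`-sector ground states —
at `tp = 0` exactly the sequence of `HubbardSuperconductivity` at `δ = 1/8` (if `U = 8` were its witness).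
HONEST: a ceiling; says nothing about the presence of pairing. [cite: Scalapino1995, §2 eq. (2.4)] -/
theorem m3_liminf_dWavePairFieldLRO_le_of_orbitLowerRow_neg {tp : ℝ} {u hi r : ℚ}
    {S : Finset (DihedralGroup 4)} (h1 : (1 : DihedralGroup 4) ∈ S) {B : Finset (Site 2)} (hBne : B.Nonempty)
    (hrow : M3CorrOrbitLowerRow tp u r S (B.biUnion (pairRegion (insert (0 : Site 2) unitSteps)))
      (-pairBoxWord (insert (0 : Site 2) unitSteps) dWaveFormFactor B))
    (hE : M3EnergyUpperRow tp hi) (hhi : hi ≤ u)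
    (ψ : ∀ L, Fock (Orb (FermionTorus 2 L)))
    (hψ : ∀ L, IsGroundStateInSector (hubbardTorusTT' L 1 tp 8) (rectN (7 / 8) L) 0 (ψ L))
    (hψ1 : ∀ L, star (ψ L) ⬝ᵥ ψ L = 1) :
    liminf (fun k : ℕ => (∑ x ∈ halfOpenBox 2 (2 * k), ∑ y ∈ halfOpenBox 2 (2 * k),
        torusPullback (pairFieldCorr dWaveFormFactor ψ) (2 * k) x y) /
          ((#(halfOpenBox 2 (2 * k)) : ℝ)) ^ 2) atTop ≤ -((r : ℚ) : ℝ) / ((B.card : ℝ)) ^ 2 :=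
  liminf_dWavePairFieldLRO_le_of_orbitLowerRow_neg h1 hBne hrow
    ((show energyDensityTT' 1 tp 8 (7 / 8) ≤ ((hi : ℚ) : ℝ) from hE).trans (by exact_mod_cast hhi)) ψ hψ hψ1

/-- **M3′ form, plain UPPER row**: `M3CorrUpperRow tp u fu Λ_B (pairBoxWord B)` + `M3EnergyUpperRow tp hi`, `hi ≤ u`
⇒ `liminf_k u_k ≤ fu/|B|²` for every family of unit sector ground states. [cite: Scalapino1995, §2 eq. (2.4)] -/
theorem m3_liminf_dWavePairFieldLRO_le_of_upperRow {tp : ℝ} {u hi fu : ℚ} {B : Finset (Site 2)} (hBne : B.Nonempty)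
    (hrow : M3CorrUpperRow tp u fu (B.biUnion (pairRegion (insert (0 : Site 2) unitSteps)))
      (pairBoxWord (insert (0 : Site 2) unitSteps) dWaveFormFactor B))
    (hE : M3EnergyUpperRow tp hi) (hhi : hi ≤ u)
    (ψ : ∀ L, Fock (Orb (FermionTorus 2 L)))
    (hψ : ∀ L, IsGroundStateInSector (hubbardTorusTT' L 1 tp 8) (rectN (7 / 8) L) 0 (ψ L))
    (hψ1 : ∀ L, star (ψ L) ⬝ᵥ ψ L = 1) :
    liminf (fun k : ℕ => (∑ x ∈ halfOpenBox 2 (2 * k), ∑ y ∈ halfOpenBox 2 (2 * k),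
        torusPullback (pairFieldCorr dWaveFormFactor ψ) (2 * k) x y) /
          ((#(halfOpenBox 2 (2 * k)) : ℝ)) ^ 2) atTop ≤ ((fu : ℚ) : ℝ) / ((B.card : ℝ)) ^ 2 :=
  liminf_dWavePairFieldLRO_le_of_upperRow hBne hrow
    ((show energyDensityTT' 1 tp 8 (7 / 8) ≤ ((hi : ℚ) : ℝ) from hE).trans (by exact_mod_cast hhi)) ψ hψ hψ1

end Row

end Summit.Ventures.CertifiedManyBodySolver.Observables

end
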